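import Mathlib
import Summits.Ventures.PercRepro2.TypedDomainInstanceSep2
import Summits.Ventures.PercRepro2.TypedBundleHarris

/-!
# The eighteen-condition domain is not empty: the separator-free 14-edge instance has no (HARRIS-1)
o-pocket (blind cell PercRepro2, p2 g7, 2026-08-26; the lead's RULING 1 (iii), R-SEP3(6))

On `ends14` (TypedDomainInstanceSep.lean) the path `o–u–a₃` (edges `0, 3`) crosses the doors `{a₁, b}`
(`noPocketA1B14`) and the path `o–u–a₁` (edges `0, 2`) the doors `{a₂, b}` (`noPocketA1BMirror14`), so
**`instance18_mem`**: the instance satisfies all eighteen conditions of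
`ResidualCoreNHatCTBRASUDO7SP2H1` — the witness of the narrowed domain (the two class instances of
TypedDomainInstanceH1Sep / H2Sep lie IN the classes, not in the narrowed domain).  Own code; standard
axioms.
-/

namespace Summit.Ventures.PercRepro2

open UnionCluster

namespace CovForm

namespace TypedRed

namespace NonVacuity14

open Separated (zF)

/-- No o-pocket on the doors `{a₁, b}`: `o–u` puts `u` on `o`'s side, `u–a₃` on the far side. -/
theorem noPocketA1B14 : ¬ PocketA1B.HasPocketA1B ends14 0 1 2 3 4 F14 := by
  rintro ⟨WO, WB, hs⟩
  have hoB : (0 : Fin 9) ∉ WB := fun h => by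
    rcases hs.cap 0 hs.oO h with h1 | hb
    · exact absurd h1 (by decide)
    · exact absurd hb (by decide)
  have h3O : (3 : Fin 9) ∉ WO := fun h => by
    rcases hs.cap 3 h hs.a3B with h1 | hb
    · exact absurd h1 (by decide)
    · exact absurd hb (by decide)
  have huO : (5 : Fin 9) ∈ WO := by
    rcases hs.split 0 (zF14 0) with w | w
    · exact (ends_mem_of_within (x := 0) (y := 5) rfl w).2
    · exact absurd (ends_mem_of_within (x := 0) (y := 5) rfl w).1 hoB
  have huB : (5 : Fin 9) ∈ WB := by
    rcases hs.split 3 (zF14 3) with w | w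
    · exact absurd (ends_mem_of_within (x := 5) (y := 3) rfl w).2 h3O
    · exact (ends_mem_of_within (x := 5) (y := 3) rfl w).1
  rcases hs.cap 5 huO huB with h | h <;> exact absurd h (by decide)

/-- No o-pocket on the doors `{a₂, b}` (the root mirror): `o–u` puts `u` on `o`'s side, `u–a₁` on
the far side. -/
theorem noPocketA1BMirror14 : ¬ PocketA1B.HasPocketA1B ends14 0 2 1 3 4 F14 := by
  rintro ⟨WO, WB, hs⟩
  have hoB : (0 : Fin 9) ∉ WB := fun h => by
    rcases hs.cap 0 hs.oO h with h2 | hb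
    · exact absurd h2 (by decide)
    · exact absurd hb (by decide)
  have h1O : (1 : Fin 9) ∉ WO := fun h => by
    rcases hs.cap 1 h hs.a2B with h2 | hb
    · exact absurd h2 (by decide)
    · exact absurd hb (by decide)
  have huO : (5 : Fin 9) ∈ WO := by
    rcases hs.split 0 (zF14 0) with w | w
    · exact (ends_mem_of_within (x := 0) (y := 5) rfl w).2
    · exact absurd (ends_mem_of_within (x := 0) (y := 5) rfl w).1 hoB
  have huB : (5 : Fin 9) ∈ WB := by
    rcases hs.split 2 (zF14 2) with w | w
    · exact absurd (ends_mem_of_within (x := 5) (y := 1) rfl w).2 h1O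
    · exact (ends_mem_of_within (x := 5) (y := 1) rfl w).1
  rcases hs.cap 5 huO huB with h | h <;> exact absurd h (by decide)

/-- **The eighteen-condition domain is not empty.** -/
theorem instance18_mem : ResidualCoreNHatCTBRASUDO7SP2H1 ends14 0 1 2 3 4 F14 :=
  ⟨instance16_mem, noPocketA1B14, noPocketA1BMirror14⟩

end NonVacuity14

end TypedRed

end CovForm

end Summit.Ventures.PercRepro2
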